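import Literature.Analysis.FluidPDE.PassiveScalarForcedEnergy
import HarnessLib

/-!
# Kinetic energy inequality for steadily SOURCED passive scalars with `L¹ₜ Ḣ¹ₓ` drift

Analysis/FluidPDE proof-support file (everything proved). For `κ > 0`, `θ₀ ∈ L²(T^d)`, a smooth
steady source `f` and a weak solution `θ ∈ L^∞(0,T; L²)` of `∂ₜθ + u·∇θ = κΔθ + f` on
`T^d × [0,T)` (`Torus.IsWeakScalarTransportForcedOn`) whose drift has
`∫₀ᵀ ‖∇u(t)‖_{L²} dt < ∞`, the KINETIC half of the energy inequality, pointwise in time: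

  `‖θ(t)‖²_{L²} ≤ ‖θ₀‖²_{L²} + 2 ∫₀ᵗ ∫ θ f`   for a.e. `t ∈ (0,T)`

(`IsWeakScalarTransportForcedOn.ae_integral_sq_le_of_lintegral_eGradNormSq_rpow_lt_top`). Its
DISSIPATION half `2κ ∫₀ᵀ ‖∇θ‖² ≤ ‖θ₀‖² + 2 ∫₀ᵀ ∫ θ f` is
`PassiveScalarForcedEnergy.energy_ineq_of_lintegral_eGradNormSq_rpow_lt_top`, and the proof is
the same DiPerna–Lions renormalisation (DiPerna–Lions 1989, §II.3, Thm. II.3) with a different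
endgame: with `Aₙ = θ ⋆ kₙ`, `β = renorm M`, the renormalised mollified identity
`∫ β(Aₙ(t)) = ∫ β(θ₀ ⋆ kₙ) + ∫₀ᵗ∫ β'(Aₙ)(Gₙ + f ⋆ kₙ)` (`PassiveScalarForcedRenormalized`), the
slice identity `∫ β'(Aₙ) Gₙ = ∫ β'(Aₙ) rₙ - κ ∫ β''(Aₙ)‖∇Aₙ‖²` (`PassiveScalarRenormalizedSlice`)
whose last term has a sign (`β'' ≥ 0`) and is dropped, the commutator `rₙ → 0` in `L¹_{t,x}`
against the bounded `β'(Aₙ)`, and the source term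
`∫₀ᵗ∫ β'(Aₙ)(f ⋆ kₙ) → ∫₀ᵗ∫ β'_M(θ) f → 2∫₀ᵗ∫ θ f`; the kinetic term is kept:
`∫ β(Aₙ(t)) → ∫ β(θ(t))` at every good time (`Aₙ(t) → θ(t)` in `L²`, `β` Lipschitz), then
`∫ β_M(θ(t)) → ∫ θ(t)²` as `M → ∞` (dominated convergence, `0 ≤ β_M ≤ y²`, `β_M = y²` on
`[-M, M]`). The elementary renormaliser and source-term limits are isolated as lemmas
(`renorm_eq_sq`, `tendsto_integral_renorm_atTop`, `abs_integral_renorm_sub_le`,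
`tendsto_integral_renormDeriv_mul`, `tendsto_integral_renormDeriv_mul_atTop`, …).
Together with the dissipation half this is the input of energy-budget arguments for steadily
sourced scalars that need the variance `‖θ(t)‖²` itself (restart at a.e. time, block estimates).

Not here: the energy EQUALITY (true for `κ > 0` by parabolic regularity, Bonicatto–Ciampa–Crippa
2024), and the `κ = 0` conservative transport balance.

## References

* R. J. DiPerna, P.-L. Lions, Invent. Math. 98 (1989), §II.3, Thm. II.3. [`DiPernaLions1989`]
* T. D. Drivas, T. M. Elgindi, G. Iyer, I.-J. Jeong, ARMA 243 (2022), (1.1)–(1.3). [`DEIJ2022`]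
-/

noncomputable section

open MeasureTheory TopologicalSpace Set Function Filter Topology Metric ContinuousLinearMap
  UnitAddTorus
open scoped ENNReal NNReal Convolution ContDiff InnerProductSpace

namespace Literature.Analysis.FluidPDE

namespace Torus

variable {d : Type*} [Fintype d]

/-! ## The renormaliser `β_M = renorm M` -/

/-- `β_M y = y²` once `|y| ≤ M` (there `β_M' r = 2r` on `[-|y|, |y|]`). [folklore] -/
theorem renorm_eq_sq {M y : ℝ} (hy : |y| ≤ M) : Calculus.renorm M y = y ^ 2 := by
  rw [Calculus.renorm]
  have h : Set.EqOn (Calculus.renormDeriv M) (fun r => 2 * r) (Set.uIcc 0 y) := by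
    intro r hr
    refine renormDeriv_eq_two_mul ?_
    rw [Set.mem_uIcc] at hr
    rcases hr with h | h
    · rw [abs_of_nonneg h.1]; exact h.2.trans ((le_abs_self y).trans hy)
    · rw [abs_of_nonpos h.2]; linarith [neg_le_abs y, h.1]
  rw [intervalIntegral.integral_congr h, intervalIntegral.integral_const_mul, integral_id]
  ring

/-- **`∫ β_M(g) → ∫ g²` as `M → ∞` (along the integers) for `g ∈ L²`**: dominated convergence
with `0 ≤ β_M(y) ≤ y²` and `β_M(y) = y²` for `M ≥ |y|`. [folklore] -/
theorem tendsto_integral_renorm_atTop {α : Type*} [MeasurableSpace α] {μ : Measure α}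
    {g : α → ℝ} (hg : MemLp g 2 μ) :
    Tendsto (fun M : ℕ => ∫ x, Calculus.renorm (M : ℝ) (g x) ∂μ) atTop (𝓝 (∫ x, g x ^ 2 ∂μ)) := by
  refine tendsto_integral_of_dominated_convergence (fun x => g x ^ 2) (fun M => ?_) hg.integrable_sq
    (fun M => Eventually.of_forall fun x => ?_) (Eventually.of_forall fun x => ?_)
  · exact (Calculus.contDiff_renorm (M : ℝ)).continuous.comp_aestronglyMeasurable hg.1
  · rw [Real.norm_eq_abs, abs_of_nonneg (Calculus.renorm_nonneg _ _)]
    exact Calculus.renorm_le_sq _ _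
  · refine tendsto_const_nhds.congr' ?_
    filter_upwards [eventually_ge_atTop ⌈|g x|⌉₊] with M hM
    rw [renorm_eq_sq ((Nat.le_ceil _).trans (Nat.cast_le.2 hM))]

/-- `β_M` is Lipschitz with constant `4 (rIn_M + 1)` (a bound for `|β_M'|`):
`|β_M a - β_M b| ≤ 4 (rIn_M + 1) |a - b|`. [folklore] -/
theorem abs_renorm_sub_renorm_le (M a b : ℝ) :
    |Calculus.renorm M a - Calculus.renorm M b| ≤ 4 * ((Calculus.truncCutoff M).rIn + 1) * |a - b| := by
  have h := (Calculus.lipschitzWith_renorm M).dist_le_mul a b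
  rwa [Real.dist_eq, Real.dist_eq, Real.coe_toNNReal _ (by linarith [(Calculus.truncCutoff M).rIn_pos])] at h

/-- `β_M ∘ c` is integrable for an integrable `c` (`|β_M y| ≤ 4(rIn_M + 1)|y|`). [folklore] -/
theorem integrable_renorm_comp {α : Type*} [MeasurableSpace α] {μ : Measure α} (M : ℝ)
    {c : α → ℝ} (hc : Integrable c μ) : Integrable (fun x => Calculus.renorm M (c x)) μ := by
  refine Integrable.mono' (hc.abs.const_mul (4 * ((Calculus.truncCutoff M).rIn + 1)))
    ((Calculus.contDiff_renorm M).continuous.comp_aestronglyMeasurable hc.aestronglyMeasurable)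
    (Eventually.of_forall fun x => ?_)
  have h := abs_renorm_sub_renorm_le M (c x) 0
  rw [Calculus.renorm_zero, sub_zero, sub_zero] at h
  rwa [Real.norm_eq_abs]

/-- `|∫ β_M(a) - ∫ β_M(b)| ≤ 4 (rIn_M + 1) ∫ |a - b|` for integrable `a`, `b`. [folklore] -/
theorem abs_integral_renorm_sub_le {α : Type*} [MeasurableSpace α] {μ : Measure α} (M : ℝ)
    {a b : α → ℝ} (ha : Integrable a μ) (hb : Integrable b μ) :
    |(∫ x, Calculus.renorm M (a x) ∂μ) - ∫ x, Calculus.renorm M (b x) ∂μ| ≤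
      4 * ((Calculus.truncCutoff M).rIn + 1) * ∫ x, |a x - b x| ∂μ := by
  rw [← integral_sub (integrable_renorm_comp M ha) (integrable_renorm_comp M hb),
    ← MeasureTheory.integral_const_mul]
  refine abs_integral_le_integral_abs.trans (integral_mono_of_nonneg
    (Eventually.of_forall fun x => abs_nonneg _) ((ha.sub hb).abs.const_mul _)
    (Eventually.of_forall fun x => ?_))
  exact abs_renorm_sub_renorm_le M (a x) (b x)

/-! ## The source term: `ε → 0` and `M → ∞` -/

/-- **The mollified source term converges** (`ε → 0` at a good time): if `Aₙ → g` in `L²(T^d)`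
(`Aₙ` continuous, `g ∈ L²`) and `Sₙ → f` uniformly with `|Sₙ| ≤ C_f` (`Sₙ`, `f` continuous),
then `∫ β_M'(Aₙ) Sₙ → ∫ β_M'(g) f`; `β_M'` is `2`-Lipschitz and `|β_M'(y)| ≤ 2|y|`. [folklore] -/
theorem tendsto_integral_renormDeriv_mul (M : ℝ)
    {g f : UnitAddTorus d → ℝ} {A S : ℕ → UnitAddTorus d → ℝ} {Cf : ℝ}
    (hg : MemLp g 2 volume) (hA : ∀ n, Continuous (A n)) (hf : Continuous f)
    (hS : ∀ n, Continuous (S n)) (hSle : ∀ n x, |S n x| ≤ Cf)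
    (hA0 : Tendsto (fun n => eLpNorm (A n - g) 2 volume) atTop (𝓝 0))
    (hS0 : ∀ η : ℝ, 0 < η → ∀ᶠ n in atTop, ∀ x, |S n x - f x| ≤ η) :
    Tendsto (fun n => ∫ x, Calculus.renormDeriv M (A n x) * S n x) atTop
      (𝓝 (∫ x, Calculus.renormDeriv M (g x) * f x)) := by
  have hgi : Integrable g volume := hg.integrable one_le_two
  have hCf0 : 0 ≤ Cf := (abs_nonneg _).trans (hSle 0 0)
  have hfle : ∀ x, |f x| ≤ Cf := fun x => by
    refine le_of_forall_pos_le_add fun η hη => ?_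
    obtain ⟨n, hn⟩ := (hS0 η hη).exists
    have h1 : |f x| ≤ |S n x| + |S n x - f x| := by
      have := abs_sub_abs_le_abs_sub (f x) (S n x)
      rw [abs_sub_comm] at this
      linarith
    linarith [hn x, hSle n x]
  set I : ℝ := ∫ x, |g x| with hI
  have hI0 : 0 ≤ I := integral_nonneg fun x => abs_nonneg _
  rw [Metric.tendsto_atTop]
  intro η hη
  set η' : ℝ := η / (2 * (Cf + I + 1)) with hη'_def
  have hη' : 0 < η' := by positivity
  obtain ⟨N₁, hN₁⟩ := eventually_atTop.1 (hS0 _ hη')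
  obtain ⟨N₂, hN₂⟩ := eventually_atTop.1
    ((ENNReal.tendsto_nhds_zero.1 hA0) (ENNReal.ofReal η') (ENNReal.ofReal_pos.2 hη'))
  refine ⟨max N₁ N₂, fun n hn => ?_⟩
  have hn1 := hN₁ n ((le_max_left _ _).trans hn)
  have hn2 := hN₂ n ((le_max_right _ _).trans hn)
  have hAi : Integrable (A n) volume := (hA n).integrable_unitAddTorus
  have hdiffL1 : ∫ x, |A n x - g x| ≤ η' := by
    have hmem : MemLp (A n - g) 2 volume :=
      ((hA n).memLp_of_hasCompactSupport (HasCompactSupport.of_compactSpace _)).sub hg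
    exact integral_abs_le_of_eLpNorm_le hmem (C := ⟨η', hη'.le⟩)
      (hn2.trans_eq (ENNReal.ofReal_eq_coe_nnreal hη'.le))
  have i1 : Integrable (fun x => Calculus.renormDeriv M (A n x) * S n x) volume :=
    (((Calculus.continuous_renormDeriv _).comp (hA n)).mul (hS n)).integrable_unitAddTorus
  have i2 : Integrable (fun x => Calculus.renormDeriv M (g x) * S n x) volume := by
    refine Integrable.mono' (hgi.abs.const_mul (2 * Cf)) (((Calculus.continuous_renormDeriv _).comp_aestronglyMeasurable
      hgi.aestronglyMeasurable).mul (hS n).aestronglyMeasurable) (Eventually.of_forall fun x => ?_)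
    rw [norm_mul, Real.norm_eq_abs, Real.norm_eq_abs]
    calc |Calculus.renormDeriv M (g x)| * |S n x| ≤ 2 * |g x| * Cf :=
          mul_le_mul (Calculus.abs_renormDeriv_le _ _) (hSle n x) (abs_nonneg _) (by positivity)
      _ = 2 * Cf * |g x| := by ring
  have i3 : Integrable (fun x => Calculus.renormDeriv M (g x) * f x) volume := by
    refine Integrable.mono' (hgi.abs.const_mul (2 * Cf)) (((Calculus.continuous_renormDeriv _).comp_aestronglyMeasurable
      hgi.aestronglyMeasurable).mul hf.aestronglyMeasurable) (Eventually.of_forall fun x => ?_)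
    rw [norm_mul, Real.norm_eq_abs, Real.norm_eq_abs]
    calc |Calculus.renormDeriv M (g x)| * |f x| ≤ 2 * |g x| * Cf :=
          mul_le_mul (Calculus.abs_renormDeriv_le _ _) (hfle x) (abs_nonneg _) (by positivity)
      _ = 2 * Cf * |g x| := by ring
  have hd1 : |(∫ x, Calculus.renormDeriv M (A n x) * S n x) - ∫ x, Calculus.renormDeriv M (g x) * S n x| ≤ 2 * Cf * η' := by
    rw [← integral_sub i1 i2]
    calc |∫ x, (Calculus.renormDeriv M (A n x) * S n x - Calculus.renormDeriv M (g x) * S n x)|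
        ≤ ∫ x, |Calculus.renormDeriv M (A n x) * S n x - Calculus.renormDeriv M (g x) * S n x| := abs_integral_le_integral_abs
      _ ≤ ∫ x, 2 * Cf * |A n x - g x| := by
          refine integral_mono_of_nonneg (Eventually.of_forall fun x => abs_nonneg _) ((hAi.sub hgi).abs.const_mul _)
            (Eventually.of_forall fun x => ?_)
          dsimp only
          rw [← sub_mul, abs_mul]
          calc |Calculus.renormDeriv M (A n x) - Calculus.renormDeriv M (g x)| * |S n x| ≤ 2 * |A n x - g x| * Cf :=
                mul_le_mul (abs_renormDeriv_sub_le _ _ _) (hSle n x) (abs_nonneg _) (by positivity)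
            _ = 2 * Cf * |A n x - g x| := by ring
      _ = 2 * Cf * ∫ x, |A n x - g x| := MeasureTheory.integral_const_mul _ _
      _ ≤ 2 * Cf * η' := mul_le_mul_of_nonneg_left hdiffL1 (by positivity)
  have hd2 : |(∫ x, Calculus.renormDeriv M (g x) * S n x) - ∫ x, Calculus.renormDeriv M (g x) * f x| ≤ 2 * I * η' := by
    rw [← integral_sub i2 i3]
    calc |∫ x, (Calculus.renormDeriv M (g x) * S n x - Calculus.renormDeriv M (g x) * f x)|
        ≤ ∫ x, |Calculus.renormDeriv M (g x) * S n x - Calculus.renormDeriv M (g x) * f x| := abs_integral_le_integral_abs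
      _ ≤ ∫ x, 2 * η' * |g x| := by
          refine integral_mono_of_nonneg (Eventually.of_forall fun x => abs_nonneg _) (hgi.abs.const_mul _)
            (Eventually.of_forall fun x => ?_)
          dsimp only
          rw [← mul_sub, abs_mul]
          calc |Calculus.renormDeriv M (g x)| * |S n x - f x| ≤ 2 * |g x| * η' :=
                mul_le_mul (Calculus.abs_renormDeriv_le _ _) (hn1 x) (abs_nonneg _) (by positivity)
            _ = 2 * η' * |g x| := by ring
      _ = 2 * η' * ∫ x, |g x| := MeasureTheory.integral_const_mul _ _
      _ = 2 * I * η' := by rw [hI]; ring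
  rw [Real.dist_eq]
  have hsum : |(∫ x, Calculus.renormDeriv M (A n x) * S n x) - ∫ x, Calculus.renormDeriv M (g x) * f x| ≤
      (2 * Cf + 2 * I) * η' := by
    calc _ ≤ |(∫ x, Calculus.renormDeriv M (A n x) * S n x) - ∫ x, Calculus.renormDeriv M (g x) * S n x| +
          |(∫ x, Calculus.renormDeriv M (g x) * S n x) - ∫ x, Calculus.renormDeriv M (g x) * f x| := abs_sub_le _ _ _
      _ ≤ _ := by linarith [hd1, hd2]
  have hlt : (2 * Cf + 2 * I) * η' < η := by
    rw [hη'_def, ← mul_div_assoc, div_lt_iff₀ (by positivity)]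
    nlinarith [hCf0, hI0]
  exact hsum.trans_lt hlt

/-- **Removing the renormalisation in the source term** (`M → ∞`): for `g ∈ L¹(T^d)` and a
continuous `f`, `∫ β_M'(g) f → 2 ∫ g f` (dominated convergence, `|β_M'(y)| ≤ 2|y|`,
`β_M'(y) = 2y` for `M ≥ |y|`). [folklore] -/
theorem tendsto_integral_renormDeriv_mul_atTop
    {g f : UnitAddTorus d → ℝ} (hg : Integrable g volume) (hf : Continuous f) :
    Tendsto (fun M : ℕ => ∫ x, Calculus.renormDeriv (M : ℝ) (g x) * f x) atTop (𝓝 (2 * ∫ x, g x * f x)) := by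
  obtain ⟨Cf, hCf⟩ := FunctionSpaces.Torus.exists_forall_norm_le_of_continuous hf
  have e2 : 2 * ∫ x, g x * f x = ∫ x, 2 * g x * f x := by
    rw [← MeasureTheory.integral_const_mul]
    exact integral_congr_ae (Eventually.of_forall fun x => by ring)
  rw [e2]
  refine tendsto_integral_of_dominated_convergence (fun x => 2 * Cf * |g x|) (fun M => ?_) (hg.abs.const_mul _)
    (fun M => Eventually.of_forall fun x => ?_) (Eventually.of_forall fun x => ?_)
  · exact ((Calculus.continuous_renormDeriv _).comp_aestronglyMeasurable hg.aestronglyMeasurable).mul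
      hf.aestronglyMeasurable
  · rw [norm_mul, Real.norm_eq_abs, Real.norm_eq_abs]
    calc |Calculus.renormDeriv (M : ℝ) (g x)| * |f x| ≤ 2 * |g x| * Cf :=
          mul_le_mul (Calculus.abs_renormDeriv_le _ _) (by simpa [Real.norm_eq_abs] using hCf x) (abs_nonneg _)
            (by positivity)
      _ = 2 * Cf * |g x| := by ring
  · refine tendsto_const_nhds.congr' ?_
    filter_upwards [eventually_ge_atTop ⌈|g x|⌉₊] with M hM
    rw [renormDeriv_eq_two_mul ((Nat.le_ceil _).trans (Nat.cast_le.2 hM))]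


/-- `|∫ β_M'(g) f| ≤ 2 C_f ∫ |g|` for an integrable `g` and `‖f‖ ≤ C_f` (`|β_M'(y)| ≤ 2|y|`).
[folklore] -/
theorem abs_integral_renormDeriv_mul_le (M : ℝ)
    {g f : UnitAddTorus d → ℝ} (hg : Integrable g volume) {Cf : ℝ} (hCf : ∀ x, ‖f x‖ ≤ Cf) :
    |∫ x, Calculus.renormDeriv M (g x) * f x| ≤ 2 * Cf * ∫ x, |g x| := by
  have hCf0 : 0 ≤ Cf := (norm_nonneg _).trans (hCf 0)
  calc |∫ x, Calculus.renormDeriv M (g x) * f x| ≤ ∫ x, |Calculus.renormDeriv M (g x) * f x| := abs_integral_le_integral_abs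
    _ ≤ ∫ x, 2 * Cf * |g x| := by
        refine integral_mono_of_nonneg (Eventually.of_forall fun x => abs_nonneg _) (hg.abs.const_mul _)
          (Eventually.of_forall fun x => ?_)
        dsimp only
        rw [abs_mul]
        calc |Calculus.renormDeriv M (g x)| * |f x| ≤ 2 * |g x| * Cf :=
              mul_le_mul (Calculus.abs_renormDeriv_le _ _) (by simpa [Real.norm_eq_abs] using hCf x) (abs_nonneg _)
                (by positivity)
          _ = 2 * Cf * |g x| := by ring
    _ = 2 * Cf * ∫ x, |g x| := MeasureTheory.integral_const_mul _ _

/-! ## Mollification: the datum and the steady source -/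

/-- **Mollification does not increase the energy**: `∫ (θ₀ ⋆ k)² ≤ ∫ θ₀²` for `θ₀ ∈ L²(T^d)` and
a smooth kernel `k` with `∫⁻ ‖k‖ₑ = 1` (Young's inequality). [folklore] -/
theorem integral_convolution_sq_le {θ₀ k : UnitAddTorus d → ℝ}
    (hθ₀ : MemLp θ₀ 2 volume) (hk : FunctionSpaces.Torus.IsSmooth k) (hk1 : ∫⁻ y, ‖k y‖ₑ = 1) :
    ∫ x, (θ₀ ⋆ k) x ^ 2 ≤ ∫ x, θ₀ x ^ 2 := by
  have hθ₀sq : 0 ≤ ∫ x, θ₀ x ^ 2 := integral_nonneg fun x => sq_nonneg _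
  have har : ENNReal.ofReal (∫ x, θ₀ x ^ 2) = ∫⁻ x, ‖θ₀ x‖ₑ ^ 2 := by
    rw [ofReal_integral_eq_lintegral_ofReal hθ₀.integrable_sq (ae_of_all _ fun x => sq_nonneg _)]
    refine lintegral_congr fun x => ?_
    rw [Real.enorm_eq_ofReal_abs, ← ENNReal.ofReal_pow (abs_nonneg _), sq_abs]
  have hc : Continuous (θ₀ ⋆ k) := FunctionSpaces.Torus.continuous_convolution (hθ₀.integrable one_le_two) hk.continuous
  have h1 : eLpNorm (θ₀ ⋆ k) 2 volume ≤ eLpNorm θ₀ 2 volume :=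
    calc eLpNorm (θ₀ ⋆ k) 2 volume ≤ (∫⁻ y, ‖k y‖ₑ) * eLpNorm θ₀ 2 volume :=
          FunctionSpaces.Torus.eLpNorm_convolution_le hθ₀.1 hk.continuous.aestronglyMeasurable one_le_two
      _ = eLpNorm θ₀ 2 volume := by rw [hk1, one_mul]
  have h2 : ENNReal.ofReal (∫ x, (θ₀ ⋆ k) x ^ 2) ≤ ENNReal.ofReal (∫ x, θ₀ x ^ 2) := by
    rw [← lintegral_enorm_sq_eq_ofReal_integral_sq hc, ← PassiveScalarProofs.eLpNorm_two_pow_two, har,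
      ← PassiveScalarProofs.eLpNorm_two_pow_two]
    gcongr
  exact (ENNReal.ofReal_le_ofReal_iff hθ₀sq).1 h2

/-- **The mollified steady source is bounded by `sup |f|`**: `|∫ f(y) k(x - y) dy| ≤ C_f` for a
continuous kernel `k ≥ 0` of unit mass and `‖f‖ ≤ C_f`. [folklore] -/
theorem abs_molInt_le_of_norm_le {f k : UnitAddTorus d → ℝ}
    (hf : Continuous f) (hk : Continuous k) (hk0 : ∀ y, 0 ≤ k y) (hk1 : ∫ y, k y = 1) {Cf : ℝ}
    (hCf : ∀ x, ‖f x‖ ≤ Cf) (x : UnitAddTorus d) : |∫ y, f y * k (x - y)| ≤ Cf := by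
  haveI : (volume : Measure (UnitAddTorus d)).IsNegInvariant := Pi.isNegInvariant_volume
  have hkc : Continuous fun y => k (x - y) := hk.comp (continuous_const.sub continuous_id)
  calc |∫ y, f y * k (x - y)| ≤ ∫ y, |f y * k (x - y)| := abs_integral_le_integral_abs
    _ ≤ ∫ y, Cf * k (x - y) := by
        refine integral_mono ((hf.mul hkc).abs.integrable_unitAddTorus)
          ((continuous_const.mul hkc).integrable_unitAddTorus) fun y => ?_
        dsimp only
        rw [abs_mul, abs_of_nonneg (hk0 _)]
        exact mul_le_mul_of_nonneg_right (by simpa [Real.norm_eq_abs] using hCf y) (hk0 _)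
    _ = Cf := by
        rw [MeasureTheory.integral_const_mul, integral_sub_left_eq_self (fun z => k z) volume x, hk1, mul_one]

/-- **The mollified steady source converges uniformly** along the kernels `k_{εₙ}`,
`εₙ = 1/(4(n+1))` (`FunctionSpaces.Torus.kernel`, `molRadius_spec`): for a continuous `f` and `η > 0`,
eventually `|∫ f(y) k_{εₙ}(x - y) dy - f(x)| ≤ η` for every `x`. [folklore] -/
theorem eventually_abs_molInt_sub_le
    {f : UnitAddTorus d → ℝ} (hf : Continuous f) {η : ℝ} (hη : 0 < η) :
    ∀ᶠ n : ℕ in atTop, ∀ x,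
      |(∫ y, f y * FunctionSpaces.Torus.kernel (1 / (4 * ((n : ℝ) + 1))) (x - y)) - f x| ≤ η := by
  obtain ⟨hε, hε', hε0⟩ := molRadius_spec
  obtain ⟨δ, hδ, hδP⟩ := FunctionSpaces.Torus.exists_forall_dist_convolution_le hf hη
  filter_upwards [(tendsto_order.1 hε0).2 δ hδ] with n hn x
  have hsupp : Function.support (FunctionSpaces.Torus.kernel (d := d) (1 / (4 * ((n : ℝ) + 1)))) ⊆ Metric.ball 0 δ :=
    (FunctionSpaces.Torus.support_kernel_subset (hε n)).trans (Metric.ball_subset_ball hn.le)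
  have h := hδP hsupp (fun y => FunctionSpaces.Torus.kernel_nonneg (hε n).le y) (FunctionSpaces.Torus.integral_kernel (hε n) (hε' n)) x
  have e : (FunctionSpaces.Torus.kernel (1 / (4 * ((n : ℝ) + 1))) ⋆ f) x =
      ∫ y, f y * FunctionSpaces.Torus.kernel (1 / (4 * ((n : ℝ) + 1))) (x - y) := by
    rw [← FunctionSpaces.Torus.convolution_comm_real]
    simp only [convolution_lsmul, smul_eq_mul]
  rwa [e, Real.dist_eq] at h


namespace IsWeakScalarTransportForcedOn

variable {T κ : ℝ} {u : ℝ → UnitAddTorus d → EuclideanSpace ℝ d} {f : UnitAddTorus d → ℝ}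
  {θ₀ : UnitAddTorus d → ℝ} {θ : ℝ → UnitAddTorus d → ℝ}

/-! ## The kinetic energy inequality -/

/-- **Kinetic half of the energy inequality for weak solutions of the steadily sourced passive
scalar equation with `L¹ₜ Ḣ¹ₓ` drift** (DiPerna–Lions 1989, §II.3 renormalisation with a smooth
steady source): for `κ > 0`, `θ₀ ∈ L²`, a smooth `f` and a weak solution `θ ∈ L^∞(0,T;L²)` of
`∂ₜθ + u·∇θ = κΔθ + f` whose drift has `∫₀ᵀ ‖∇u(t)‖_{L²} dt < ∞`, for a.e. `t ∈ (0,T)`,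
`∫ θ(t)² ≤ ∫ θ₀² + 2 ∫_{(0,t]} ∫ θ f`. [cite: DiPernaLions1989, §II.3 Thm. II.3] -/
theorem ae_integral_sq_le_of_lintegral_eGradNormSq_rpow_lt_top (hκ : 0 < κ)
    (h : IsWeakScalarTransportForcedOn T κ u (fun _ => f) θ₀ θ)
    (hθ₀ : MemLp θ₀ 2 volume) (hf : FunctionSpaces.Torus.IsSmooth f)
    (hG : ∫⁻ t in Ioo 0 T, FunctionSpaces.Torus.eGradNormSq (u t) ^ (1 / 2 : ℝ) < ⊤) :
    ∀ᵐ t ∂(volume.restrict (Ioo 0 T)),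
      ∫ x, θ t x ^ 2 ≤ (∫ x, θ₀ x ^ 2) + 2 * ∫ τ in Ioc 0 t, ∫ x, θ τ x * f x := by
  classical
  set μT : Measure ℝ := (volume : Measure ℝ).restrict (Ioo 0 T) with hμT
  haveI : IsFiniteMeasure μT := by rw [hμT]; infer_instance
  -- radii and kernels
  obtain ⟨hε, hε', hε0⟩ := molRadius_spec
  set ε : ℕ → ℝ := fun n => 1 / (4 * ((n : ℝ) + 1)) with hε_def
  set kk : ℕ → UnitAddTorus d → ℝ := fun n => FunctionSpaces.Torus.kernel (d := d) (ε n) with hkk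
  have hkS : ∀ n, FunctionSpaces.Torus.IsSmooth (kk n) := fun n => FunctionSpaces.Torus.isSmooth_kernel (hε n) (hε' n)
  have hk1 : ∀ n, ∫⁻ y, ‖kk n y‖ₑ = 1 := fun n => FunctionSpaces.Torus.lintegral_enorm_kernel (hε n) (hε' n)
  have hk0 : ∀ n y, 0 ≤ kk n y := fun n y => FunctionSpaces.Torus.kernel_nonneg (hε n).le y
  have hkint : ∀ n, ∫ y, kk n y = 1 := fun n => FunctionSpaces.Torus.integral_kernel (hε n) (hε' n)
  -- the source: sup bound, mollification and its uniform convergence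
  have hconv : ∀ (δ : UnitAddTorus d → ℝ) (n : ℕ) (x : UnitAddTorus d), (δ ⋆ kk n) x = ∫ y, δ y * kk n (x - y) :=
    fun δ n x => by simp only [convolution_lsmul, smul_eq_mul]
  obtain ⟨Cf, hCf⟩ := FunctionSpaces.Torus.exists_forall_norm_le_of_continuous hf.continuous
  set Sn : ℕ → UnitAddTorus d → ℝ := fun n x => ∫ y, f y * kk n (x - y) with hSn_def
  have hSn_cont : ∀ n, Continuous (Sn n) := fun n => by
    have e : Sn n = f ⋆ kk n := funext fun x => (hconv f n x).symm
    rw [e]; exact FunctionSpaces.Torus.continuous_convolution hf.continuous.integrable_unitAddTorus (hkS n).continuous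
  have hSn_le : ∀ n x, |Sn n x| ≤ Cf := fun n x =>
    abs_molInt_le_of_norm_le hf.continuous (hkS n).continuous (hk0 n) (hkint n) hCf x
  have hSn_unif : ∀ η : ℝ, 0 < η → ∀ᶠ n in atTop, ∀ x, |Sn n x - f x| ≤ η := fun η hη =>
    eventually_abs_molInt_sub_le hf.continuous hη
  -- bounds on the slices
  obtain ⟨C₁, hC₁⟩ := h.exists_eLpNorm_le
  have hθ₀i : Integrable θ₀ volume := hθ₀.integrable one_le_two
  have hGm : AEMeasurable (fun t => FunctionSpaces.Torus.eGradNormSq (u t)) μT :=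
    aemeasurable_eGradNormSq_slice h.aestronglyMeasurable_uncurry_velocity
  have hgood : ∀ᵐ s ∂μT, (Integrable (θ s) volume ∧ AEStronglyMeasurable (u s) volume ∧
      Integrable (fun y => ‖u s y‖ * θ s y) volume) ∧ FunctionSpaces.Torus.IsWeaklyDivFree (u s) ∧
      MemLp (θ s) 2 volume ∧ eLpNorm (θ s) 2 volume ≤ C₁ ∧ Integrable (u s) volume ∧ MemLp (u s) 2 volume ∧
      FunctionSpaces.Torus.eGradNormSq (u s) < ⊤ := by
    have hGfin : ∀ᵐ s ∂μT, FunctionSpaces.Torus.eGradNormSq (u s) < ⊤ := by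
      have h1 : ∀ᵐ s ∂μT, FunctionSpaces.Torus.eGradNormSq (u s) ^ (1 / 2 : ℝ) < ⊤ :=
        ae_lt_top' (hGm.pow_const _) hG.ne
      filter_upwards [h1] with s hs
      by_contra htop
      rw [not_lt, top_le_iff] at htop
      rw [htop, ENNReal.top_rpow_of_pos (by norm_num)] at hs
      exact lt_irrefl _ hs
    filter_upwards [h.ae_slice_integrable₁, h.ae_isWeaklyDivFree, h.ae_memLp_two, hC₁, h.ae_integrable_velocity,
      h.ae_memLp_two_velocity, hGfin] with s h1 h2 h3 h4 h5 h6 h7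
    exact ⟨⟨h1.1, h1.2.1, h1.2.2.1⟩, h2, h3, h4, h5, h6, h7⟩
  -- ### the commutator size `ρ n s = ∫ |r_n(s,x)| dx`
  set ρ : ℕ → ℝ → ℝ≥0∞ := fun n s => ∫⁻ x, ‖∫ y, θ s y * ⟪u s x - u s y,
    FunctionSpaces.Torus.gradient (kk n) (x - y)⟫_ℝ‖ₑ with hρ_def
  have hρm : ∀ n, AEMeasurable (ρ n) μT := fun n => h.aemeasurable_lintegral_enorm_comm (hkS n)
  set Kρ : ℝ → ℝ≥0∞ := fun s => (C₁ : ℝ≥0∞) * FunctionSpaces.Torus.eGradNormSq (u s) ^ (1 / 2 : ℝ) *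
    ENNReal.ofReal (FunctionSpaces.Torus.gradProfileMass d) with hKρ
  have hKρt : ∫⁻ s, Kρ s ∂μT ≠ ⊤ := by
    rw [hKρ, lintegral_mul_const'' _ ((hGm.pow_const _).const_mul _), lintegral_const_mul'' _ (hGm.pow_const _)]
    exact ENNReal.mul_ne_top (ENNReal.mul_ne_top ENNReal.coe_ne_top hG.ne) ENNReal.ofReal_ne_top
  have hρle : ∀ n, ∀ᵐ s ∂μT, ρ n s ≤ Kρ s := by
    intro n
    filter_upwards [hgood] with s hs
    obtain ⟨-, -, hθ2, hθC, -, hu2, -⟩ := hs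
    refine (IsWeakScalarTransportOn.lintegral_enorm_comm_le_eGradNormSq hθ2 hu2 (hε n) (hε' n)).trans ?_
    simp only [hKρ]
    gcongr
  have hρ0 : ∀ᵐ s ∂μT, Tendsto (fun n => ρ n s) atTop (𝓝 0) := by
    filter_upwards [hgood] with s hs
    obtain ⟨⟨-, -, huθ⟩, hdiv, hθ2, -, hui, hu2, huG⟩ := hs
    exact tendsto_lintegral_enorm_comm hθ2 hui huθ hdiv (B := FunctionSpaces.Torus.eGradNormSq (u s) ^ (1 / 2 : ℝ))
      (ENNReal.rpow_ne_top_of_nonneg (by norm_num) huG.ne) hε hε' hε0 fun n z hz =>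
      IsWeakScalarTransportOn.eLpNorm_sub_translate_le_of_gradient_kernel_ne_zero hu2 (hε n) (hε' n) hz
  have hP0 : Tendsto (fun n => ∫⁻ s, ρ n s ∂μT) atTop (𝓝 0) := by
    have := tendsto_lintegral_of_dominated_convergence' Kρ hρm hρle hKρt
      (hρ0.mono fun s hs => by simpa using hs)
    simpa using this
  have hPt : ∀ n, ∫⁻ s, ρ n s ∂μT ≠ ⊤ := fun n =>
    ne_top_of_le_ne_top hKρt (lintegral_mono_ae (hρle n))
  have hP0' : Tendsto (fun n => (∫⁻ s, ρ n s ∂μT).toReal) atTop (𝓝 0) := by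
    have h5 := (ENNReal.tendsto_toReal ENNReal.zero_ne_top).comp hP0
    rwa [ENNReal.toReal_zero] at h5
  have hKρfin : ∀ᵐ s ∂μT, Kρ s < ⊤ :=
    ae_lt_top' (((hGm.pow_const _).const_mul _).mul_const _) hKρt
  -- ### the datum term (real form)
  set ar : ℝ := ∫ x, θ₀ x ^ 2 with har_def
  have ha0 : ∀ n, ∫ x, (θ₀ ⋆ kk n) x ^ 2 ≤ ar := fun n =>
    integral_convolution_sq_le hθ₀ (hkS n) (hk1 n)
  -- ### the source terms
  set Q : ℕ → ℕ → ℝ → ℝ := fun M n τ => ∫ x, Calculus.renormDeriv (M : ℝ) (∫ y, θ τ y * kk n (x - y)) * Sn n x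
    with hQ_def
  set QM : ℕ → ℝ → ℝ := fun M τ => ∫ x, Calculus.renormDeriv (M : ℝ) (θ τ x) * f x with hQM_def
  set g : ℝ → ℝ := fun τ => ∫ x, θ τ x * f x with hg_def
  set Src : ℝ → ℝ := fun t => 2 * ∫ τ in Ioc 0 t, g τ with hSrc_def
  set SrcMn : ℕ → ℕ → ℝ → ℝ := fun M n t => ∫ τ in Ioc 0 t, Q M n τ with hSrcMn_def
  set SrcM : ℕ → ℝ → ℝ := fun M t => ∫ τ in Ioc 0 t, QM M τ with hSrcM_def
  set Cβ : ℕ → ℝ := fun M => 4 * ((Calculus.truncCutoff (M : ℝ)).rIn + 1) with hCβ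
  have hCβ0 : ∀ M, 0 ≤ Cβ M := fun M => by
    have := (Calculus.truncCutoff (M : ℝ)).rIn_pos; rw [hCβ]; positivity
  have hβ'b : ∀ (M : ℕ) (y : ℝ), |Calculus.renormDeriv (M : ℝ) y| ≤ Cβ M := fun M y =>
    Calculus.abs_renormDeriv_le_const (M : ℝ) y
  -- measurability and bounds of `Q`, `QM`
  have hQm : ∀ M n, AEStronglyMeasurable (Q M n) μT := by
    intro M n
    have hm : AEStronglyMeasurable (uncurry fun τ x => Calculus.renormDeriv (M : ℝ) (∫ y, θ τ y * kk n (x - y)) * Sn n x)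
        (μT.prod volume) :=
      ((Calculus.continuous_renormDeriv (M : ℝ)).comp_aestronglyMeasurable
        (h.aestronglyMeasurable_uncurry_molInt₁ (hkS n).continuous)).mul
        ((hSn_cont n).comp_aestronglyMeasurable measurable_snd.aestronglyMeasurable)
    exact hm.integral_prod_right'
  have hQb : ∀ M n τ, |Q M n τ| ≤ Cβ M * Cf := by
    intro M n τ
    rw [← Real.norm_eq_abs]
    refine (norm_integral_le_of_norm_le_const (C := Cβ M * Cf) (Eventually.of_forall fun x => ?_)).trans (le_of_eq ?_)
    · rw [norm_mul, Real.norm_eq_abs, Real.norm_eq_abs]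
      exact mul_le_mul (hβ'b M _) (hSn_le n x) (abs_nonneg _) (hCβ0 M)
    · rw [probReal_univ, mul_one]
  have hQi : ∀ M n, Integrable (Q M n) μT := fun M n =>
    Integrable.mono' (integrable_const (Cβ M * Cf)) (hQm M n) (Eventually.of_forall fun τ => by
      rw [Real.norm_eq_abs]; exact hQb M n τ)
  have hQMm : ∀ M, AEStronglyMeasurable (QM M) μT := by
    intro M
    have hm : AEStronglyMeasurable (uncurry fun τ x => Calculus.renormDeriv (M : ℝ) (θ τ x) * f x) (μT.prod volume) :=
      ((Calculus.continuous_renormDeriv (M : ℝ)).comp_aestronglyMeasurable h.aestronglyMeasurable_uncurry).mul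
        (hf.continuous.comp_aestronglyMeasurable measurable_snd.aestronglyMeasurable)
    exact hm.integral_prod_right'
  have hθ1 : ∀ᵐ τ ∂μT, ∫ x, |θ τ x| ≤ C₁ := by
    filter_upwards [hgood] with τ hτ
    exact integral_abs_le_of_eLpNorm_le hτ.2.2.1 hτ.2.2.2.1
  have hQMb : ∀ M, ∀ᵐ τ ∂μT, |QM M τ| ≤ 2 * Cf * C₁ := by
    intro M
    have hCf0 : 0 ≤ Cf := (norm_nonneg _).trans (hCf 0)
    filter_upwards [hθ1, hgood] with τ hτ hg'
    exact (abs_integral_renormDeriv_mul_le (M : ℝ) hg'.1.1 hCf).trans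
      (mul_le_mul_of_nonneg_left hτ (by positivity))
  -- convergence `Q M n τ → QM M τ` (`n → ∞`) at good `τ`, and `SrcMn M n t → SrcM M t`
  have hE0 : ∀ᵐ s ∂μT, Tendsto (fun n => eLpNorm (θ s ⋆ kk n - θ s) 2 volume) atTop (𝓝 0) := by
    filter_upwards [hgood] with s hs
    exact FunctionSpaces.Torus.tendsto_eLpNorm_convolution_sub_self hs.2.2.1
      (fun n y => FunctionSpaces.Torus.kernel_nonneg (hε n).le y)
      (fun n => FunctionSpaces.Torus.integral_kernel (hε n) (hε' n)) (fun n => FunctionSpaces.Torus.support_kernel_subset (hε n))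
      (fun n => FunctionSpaces.Torus.continuous_kernel (hε n) (hε' n)) hε0
  have hQlim : ∀ M, ∀ᵐ τ ∂μT, Tendsto (fun n => Q M n τ) atTop (𝓝 (QM M τ)) := by
    intro M
    filter_upwards [hgood, hE0] with τ hτ hτ0
    obtain ⟨⟨hθi, -, -⟩, -, hθ2, -⟩ := hτ
    have e : (fun n => Q M n τ) = fun n => ∫ x, Calculus.renormDeriv (M : ℝ) ((θ τ ⋆ kk n) x) * Sn n x := by
      funext n; simp only [hQ_def, hconv]
    rw [e]
    exact tendsto_integral_renormDeriv_mul (M : ℝ) hθ2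
      (fun n => FunctionSpaces.Torus.continuous_convolution hθi (hkS n).continuous) hf.continuous hSn_cont hSn_le hτ0 hSn_unif
  have hSrcMn_lim : ∀ M, ∀ t ∈ Ioo 0 T, Tendsto (fun n => SrcMn M n t) atTop (𝓝 (SrcM M t)) := by
    intro M t ht
    have hsub : Ioc 0 t ⊆ Ioo 0 T := Ioc_subset_Ioo_right ht.2
    have hle : (volume : Measure ℝ).restrict (Ioc 0 t) ≤ μT := Measure.restrict_mono_set _ hsub
    haveI : IsFiniteMeasure ((volume : Measure ℝ).restrict (Ioc 0 t)) := by infer_instance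
    refine tendsto_integral_of_dominated_convergence (fun _ => Cβ M * Cf) (fun n => (hQm M n).mono_measure hle)
      (integrable_const _) (fun n => Eventually.of_forall fun τ => ?_) (ae_restrict_of_ae_restrict_of_subset hsub (hQlim M))
    rw [Real.norm_eq_abs]
    exact hQb M n τ
  -- `SrcM M t → Src t` (`M → ∞`) for `t ∈ (0,T)`
  have hQMlim : ∀ᵐ τ ∂μT, Tendsto (fun M : ℕ => QM M τ) atTop (𝓝 (2 * g τ)) := by
    filter_upwards [hgood] with τ hτ
    exact tendsto_integral_renormDeriv_mul_atTop hτ.1.1 hf.continuous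
  have hSrcM_lim : ∀ t ∈ Ioo 0 T, Tendsto (fun M : ℕ => SrcM M t) atTop (𝓝 (Src t)) := by
    intro t ht
    have hsub : Ioc 0 t ⊆ Ioo 0 T := Ioc_subset_Ioo_right ht.2
    have hle : (volume : Measure ℝ).restrict (Ioc 0 t) ≤ μT := Measure.restrict_mono_set _ hsub
    haveI : IsFiniteMeasure ((volume : Measure ℝ).restrict (Ioc 0 t)) := by infer_instance
    have e : Src t = ∫ τ in Ioc 0 t, 2 * g τ := by
      simp only [hSrc_def]
      exact (MeasureTheory.integral_const_mul _ _).symm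
    rw [e]
    refine tendsto_integral_of_dominated_convergence (fun _ => 2 * Cf * C₁) (fun M => (hQMm M).mono_measure hle)
      (integrable_const _) (fun M => ?_) (ae_restrict_of_ae_restrict_of_subset hsub hQMlim)
    refine ae_restrict_of_ae_restrict_of_subset hsub ((hQMb M).mono fun τ hτ => ?_)
    rw [Real.norm_eq_abs]
    exact hτ
  -- ### **the core estimate**: for a.e. `t`,
  --     `∫ β_M(A_n(t)) ≤ ar + Cβ_M (∫⁻ ρ_n).toReal + SrcMn M n t`
  have hcore : ∀ (M n : ℕ), ∀ᵐ t ∂μT, ∫ x, Calculus.renorm (M : ℝ) (∫ y, θ t y * kk n (x - y)) ≤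
      ar + Cβ M * (∫⁻ s, ρ n s ∂μT).toReal + SrcMn M n t := by
    intro M n
    have hβ : ContDiff ℝ 1 (Calculus.renorm (M : ℝ)) := (Calculus.contDiff_renorm (M : ℝ)).of_le (by simp)
    have hβtop : ContDiff ℝ ∞ (Calculus.renorm (M : ℝ)) := Calculus.contDiff_renorm (M : ℝ)
    have hβK := Calculus.lipschitzWith_renorm (M : ℝ)
    have hβ'bd : ∀ y, |deriv (Calculus.renorm (M : ℝ)) y| ≤ Cβ M := fun y => by
      rw [Calculus.deriv_renorm]; exact hβ'b M y
    have hβ'c : Continuous (deriv (Calculus.renorm (M : ℝ))) := hβ.continuous_deriv le_rfl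
    -- the time-integrands on `(0,T)`
    set Φ : ℝ → ℝ := fun s => ∫ x, deriv (Calculus.renorm (M : ℝ)) (∫ y, θ s y * kk n (x - y)) *
      ((∫ y, θ s y * (-⟪u s y, FunctionSpaces.Torus.gradient (kk n) (x - y)⟫_ℝ + κ * FunctionSpaces.Torus.laplacian (kk n) (x - y))) +
        ∫ y, f y * kk n (x - y)) with hΦ_def
    set R : ℝ → ℝ := fun s => ∫ x, deriv (Calculus.renorm (M : ℝ)) ((θ s ⋆ kk n) x) *
      ∫ y, θ s y * ⟪u s x - u s y, FunctionSpaces.Torus.gradient (kk n) (x - y)⟫_ℝ with hR_def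
    have hΦi : Integrable Φ μT := (h.integrable_comp_molInt_mul_flux (hkS n) hβ'c hβ'bd).integral_prod_left
    -- the slice inequality `Φ ≤ R + Q` a.e. (the renormalised dissipation has a sign)
    have hslice : ∀ᵐ s ∂μT, Φ s ≤ R s + Q M n s := by
      filter_upwards [hgood] with s hs
      obtain ⟨⟨hθi, hum, huθ⟩, hdiv, -, -, hui, -⟩ := hs
      have hid := integral_deriv_comp_mul_flux_eq hβtop hθi hui huθ hdiv (hkS n) κ
      have hA : FunctionSpaces.Torus.IsSmooth (θ s ⋆ kk n) := FunctionSpaces.Torus.isSmooth_convolution hθi (hkS n)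
      have hbc : Continuous fun x => deriv (Calculus.renorm (M : ℝ)) ((θ s ⋆ kk n) x) := hβ'c.comp hA.continuous
      have hGc := continuous_fluxIntegral hθi hum huθ (hkS n) κ
      have jG : Integrable (fun x => deriv (Calculus.renorm (M : ℝ)) ((θ s ⋆ kk n) x) *
          ∫ y, θ s y * (-⟪u s y, FunctionSpaces.Torus.gradient (kk n) (x - y)⟫_ℝ + κ * FunctionSpaces.Torus.laplacian (kk n) (x - y)))
          volume := (hbc.mul hGc).integrable_unitAddTorus
      have jS : Integrable (fun x => deriv (Calculus.renorm (M : ℝ)) ((θ s ⋆ kk n) x) * Sn n x) volume :=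
        (hbc.mul (hSn_cont n)).integrable_unitAddTorus
      have e1 : Φ s = ∫ x, (deriv (Calculus.renorm (M : ℝ)) ((θ s ⋆ kk n) x) *
          (∫ y, θ s y * (-⟪u s y, FunctionSpaces.Torus.gradient (kk n) (x - y)⟫_ℝ + κ * FunctionSpaces.Torus.laplacian (kk n) (x - y))) +
          deriv (Calculus.renorm (M : ℝ)) ((θ s ⋆ kk n) x) * Sn n x) := by
        simp only [hΦ_def, hconv, hSn_def, mul_add]
      have e3 : Q M n s = ∫ x, deriv (Calculus.renorm (M : ℝ)) ((θ s ⋆ kk n) x) * Sn n x := by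
        simp only [hQ_def, Calculus.deriv_renorm, hconv]
      have key : Φ s = R s - κ * (∫ x, deriv (deriv (Calculus.renorm (M : ℝ))) ((θ s ⋆ kk n) x) *
          ‖FunctionSpaces.Torus.gradient (θ s ⋆ kk n) x‖ ^ 2) + Q M n s := by
        rw [e1, integral_add jG jS, hid, e3]
      have hDpos : 0 ≤ κ * (∫ x, deriv (deriv (Calculus.renorm (M : ℝ))) ((θ s ⋆ kk n) x) *
          ‖FunctionSpaces.Torus.gradient (θ s ⋆ kk n) x‖ ^ 2) := by
        refine mul_nonneg hκ.le (integral_nonneg fun x => mul_nonneg ?_ (sq_nonneg _))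
        rw [Calculus.deriv_renorm]
        exact Calculus.deriv_renormDeriv_nonneg _ _
      linarith
    -- the bound `|R| ≤ C_M ρ` a.e.
    have hRle : ∀ᵐ s ∂μT, |R s| ≤ Cβ M * (ρ n s).toReal := by
      filter_upwards [hρle n, hgood, hKρfin] with s hs hg' hKs
      obtain ⟨⟨hθi, hum, -⟩, -⟩ := hg'
      have hKc : Continuous fun p : UnitAddTorus d × UnitAddTorus d =>
          FunctionSpaces.Torus.gradient (kk n) (p.1 - p.2) :=
        (hkS n).gradient.continuous.comp (continuous_fst.sub continuous_snd)
      have hP : AEStronglyMeasurable (Function.uncurry fun (x y : UnitAddTorus d) => θ s y * ⟪u s x - u s y,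
          FunctionSpaces.Torus.gradient (kk n) (x - y)⟫_ℝ) ((volume : Measure (UnitAddTorus d)).prod volume) :=
        (hθi.aestronglyMeasurable.comp_snd).mul (((hum.comp_fst).sub (hum.comp_snd)).inner hKc.aestronglyMeasurable)
      have hrm : AEStronglyMeasurable (fun x => ∫ y, θ s y * ⟪u s x - u s y,
          FunctionSpaces.Torus.gradient (kk n) (x - y)⟫_ℝ) volume := hP.integral_prod_right'
      exact IsWeakScalarTransportOn.abs_integral_mul_le_mul_toReal_lintegral (fun x => hβ'bd _) hrm (hs.trans_lt hKs)
    -- now the good times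
    filter_upwards [h.ae_integral_comp_molInt_eq hθ₀i (hkS n) hβ hβK, ae_restrict_mem measurableSet_Ioo]
      with t hid htT
    have hsub : Ioc 0 t ⊆ Ioo 0 T := Ioc_subset_Ioo_right htT.2
    have hle : (volume : Measure ℝ).restrict (Ioc 0 t) ≤ μT := Measure.restrict_mono_set _ hsub
    have hΦi' : IntegrableOn Φ (Ioc 0 t) volume := hΦi.mono_measure hle
    have hQi' : IntegrableOn (Q M n) (Ioc 0 t) volume := (hQi M n).mono_measure hle
    have hρi' : IntegrableOn (fun s => Cβ M * (ρ n s).toReal) (Ioc 0 t) volume :=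
      ((integrable_toReal_of_lintegral_ne_top (hρm n) (hPt n)).const_mul (Cβ M)).mono_measure hle
    -- `∫_{(0,t]} Φ ≤ Cβ_M ∫_{(0,t]} ρ_n + ∫_{(0,t]} Q`
    have hsplit : ∫ s in Ioc 0 t, Φ s ≤
        Cβ M * (∫ s in Ioc 0 t, (ρ n s).toReal) + ∫ s in Ioc 0 t, Q M n s := by
      rw [← MeasureTheory.integral_const_mul, ← integral_add hρi' hQi']
      refine integral_mono_ae hΦi' (hρi'.add hQi') ?_
      filter_upwards [ae_restrict_of_ae_restrict_of_subset hsub hslice,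
        ae_restrict_of_ae_restrict_of_subset hsub hRle] with s h1 h2
      linarith [le_abs_self (R s)]
    -- the renormalised identity in real form
    have hidΦ : ∫ x, Calculus.renorm (M : ℝ) (∫ y, θ t y * kk n (x - y)) =
        (∫ x, Calculus.renorm (M : ℝ) (∫ y, θ₀ y * kk n (x - y))) + ∫ s in Ioc 0 t, Φ s := by
      simpa only using hid
    have hdat : ∫ x, Calculus.renorm (M : ℝ) (∫ y, θ₀ y * kk n (x - y)) ≤ ∫ x, (θ₀ ⋆ kk n) x ^ 2 := by
      have hc : Continuous (θ₀ ⋆ kk n) := FunctionSpaces.Torus.continuous_convolution hθ₀i (hkS n).continuous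
      have e : (fun x => Calculus.renorm (M : ℝ) (∫ y, θ₀ y * kk n (x - y))) = fun x => Calculus.renorm (M : ℝ) ((θ₀ ⋆ kk n) x) :=
        funext fun x => by rw [hconv]
      rw [e]
      exact integral_mono ((Calculus.contDiff_renorm (M : ℝ)).continuous.comp hc).integrable_unitAddTorus
        (hc.pow 2).integrable_unitAddTorus fun x => Calculus.renorm_le_sq _ _
    have hρint : ∫ s in Ioc 0 t, (ρ n s).toReal ≤ (∫⁻ s, ρ n s ∂μT).toReal := by
      have h1 : ∫ s in Ioc 0 t, (ρ n s).toReal ≤ ∫ s, (ρ n s).toReal ∂μT :=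
        integral_mono_measure hle (Eventually.of_forall fun s => ENNReal.toReal_nonneg)
          (integrable_toReal_of_lintegral_ne_top (hρm n) (hPt n))
      have h2 : ∫ s, (ρ n s).toReal ∂μT = (∫⁻ s, ρ n s ∂μT).toReal :=
        integral_toReal (hρm n) ((hρle n).mp (hKρfin.mono fun s h1 h2 => h2.trans_lt h1))
      exact h1.trans h2.le
    have hsrc : ∫ s in Ioc 0 t, Q M n s = SrcMn M n t := rfl
    have := mul_le_mul_of_nonneg_left hρint (hCβ0 M)
    linarith [hidΦ, hdat, ha0 n, hsplit]
  -- ### `n → ∞` at a.e. `t`: the kinetic term `∫ β_M(A_n(t)) → ∫ β_M(θ(t))`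
  have hKin : ∀ᵐ t ∂μT, ∀ M : ℕ, ∫ x, Calculus.renorm (M : ℝ) (θ t x) ≤ ar + SrcM M t := by
    have hcore' : ∀ᵐ t ∂μT, ∀ M n : ℕ, ∫ x, Calculus.renorm (M : ℝ) (∫ y, θ t y * kk n (x - y)) ≤
        ar + Cβ M * (∫⁻ s, ρ n s ∂μT).toReal + SrcMn M n t :=
      ae_all_iff.2 fun M => ae_all_iff.2 fun n => hcore M n
    filter_upwards [hcore', hgood, hE0, ae_restrict_mem measurableSet_Ioo] with t hct hg' ht0 htT M
    obtain ⟨⟨hθi, -, -⟩, -, hθ2, -⟩ := hg'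
    -- `A_n(t) → θ(t)` in `L¹`
    have hL1 : Tendsto (fun n => ∫ x, |(θ t ⋆ kk n) x - θ t x|) atTop (𝓝 0) := by
      have h1 : Tendsto (fun n => ((eLpNorm (θ t ⋆ kk n - θ t) 2 volume).toNNReal : ℝ)) atTop (𝓝 0) := by
        have h2 := (ENNReal.tendsto_toReal ENNReal.zero_ne_top).comp ht0
        rw [ENNReal.toReal_zero] at h2
        exact h2
      refine squeeze_zero (fun n => integral_nonneg fun x => abs_nonneg _) (fun n => ?_) h1
      have hmem : MemLp (θ t ⋆ kk n - θ t) 2 volume :=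
        ((FunctionSpaces.Torus.isSmooth_convolution hθi (hkS n)).memLp 2).sub hθ2
      exact integral_abs_le_of_eLpNorm_le hmem (ENNReal.coe_toNNReal hmem.eLpNorm_ne_top).ge
    have hbound : ∀ n, ∫ x, Calculus.renorm (M : ℝ) (θ t x) ≤ ar + Cβ M * (∫⁻ s, ρ n s ∂μT).toReal + SrcMn M n t +
        Cβ M * ∫ x, |(θ t ⋆ kk n) x - θ t x| := by
      intro n
      have hAc : Continuous (θ t ⋆ kk n) := FunctionSpaces.Torus.continuous_convolution hθi (hkS n).continuous
      have h1 : |(∫ x, Calculus.renorm (M : ℝ) ((θ t ⋆ kk n) x)) - ∫ x, Calculus.renorm (M : ℝ) (θ t x)| ≤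
          Cβ M * ∫ x, |(θ t ⋆ kk n) x - θ t x| :=
        abs_integral_renorm_sub_le (M : ℝ) hAc.integrable_unitAddTorus hθi
      have h2 := hct M n
      have e : (fun x => Calculus.renorm (M : ℝ) (∫ y, θ t y * kk n (x - y))) = fun x => Calculus.renorm (M : ℝ) ((θ t ⋆ kk n) x) :=
        funext fun x => by rw [hconv]
      rw [e] at h2
      have h3 := (abs_sub_le_iff.1 h1).2
      linarith
    have hlim : Tendsto (fun n => ar + Cβ M * (∫⁻ s, ρ n s ∂μT).toReal + SrcMn M n t +
        Cβ M * ∫ x, |(θ t ⋆ kk n) x - θ t x|) atTop (𝓝 (ar + Cβ M * 0 + SrcM M t + Cβ M * 0)) :=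
      (((tendsto_const_nhds (x := ar)).add ((tendsto_const_nhds (x := Cβ M)).mul hP0')).add
        (hSrcMn_lim M t htT)).add ((tendsto_const_nhds (x := Cβ M)).mul hL1)
    rw [mul_zero, add_zero, add_zero] at hlim
    exact ge_of_tendsto' hlim hbound
  -- ### `M → ∞` at a.e. `t`
  filter_upwards [hKin, hgood, ae_restrict_mem measurableSet_Ioo] with t hK hg' htT
  obtain ⟨-, -, hθ2, -⟩ := hg'
  have h1 : Tendsto (fun M : ℕ => ∫ x, Calculus.renorm (M : ℝ) (θ t x)) atTop (𝓝 (∫ x, θ t x ^ 2)) :=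
    tendsto_integral_renorm_atTop hθ2
  have h2 : Tendsto (fun M : ℕ => ar + SrcM M t) atTop (𝓝 (ar + Src t)) :=
    (tendsto_const_nhds (x := ar)).add (hSrcM_lim t htT)
  exact le_of_tendsto_of_tendsto' h1 h2 hK

end IsWeakScalarTransportForcedOn

end Torus

end Literature.Analysis.FluidPDE
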